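import Literature.NumberTheory.DiophantineApproximation.FactorialRatioRate
import Mathlib.Analysis.SpecialFunctions.Stirling
import Mathlib.Analysis.Asymptotics.Lemmas
import HarnessLib

/-!
# Exponential rate of `4^(wn) (wn)! ((2wn)!)^w / (((2w+1)n+1)!)^w`

Topic `Literature/NumberTheory/DiophantineApproximation`. Everything in this file is PROVED.

For a weight `w ≥ 1`, the quantity `K_n = 4^(wn) (wn)! ((2wn)!)^w / (((2w+1)n+1)!)^w` is the
first non-vanishing coefficient of the parity (two-point, `±1/N`) type-I Hermite–Padé forms used
for the linear independence of polylogarithmic values at `±1/N`; its exponential decay rate enters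
the threshold of that result. We prove the sharp rate: for every `ε > 0`,

  `exp (-(w ((2w+1) log ((2w+1)/(2w)) - log 2) + ε) n) ≤ K_n`  for all large `n`

(`eventually_exp_le_kernelH_self`), i.e. the rate is
`κ_H(w) = w ((2w+1) log ((2w+1)/(2w)) - log 2)` (`κ_H(1) = 3 log (3/2) - log 2 = 0.523…`,
`κ_H(2) = 10 log (5/4) - 2 log 2 = 0.845…`, …).

Proof: Stirling's formula via Mathlib, exactly as for `(wn)!^(w+1) / (((w+1)n+1)!)^w` in
`FactorialPowerRate`. The lower bound `a log a - a ≤ log a!` (`a ≥ 1`) is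
`Stirling.le_log_factorial_stirling` (dropping non-negative terms), applied to `a = wn` and
`a = 2wn`; the upper bound `log b! ≤ b log b - b + (log b)/2 + 1` for `b = (2w+1)n + 1` is
`log_factorial_succ_le`. The linear terms cancel (`wn + 2w²n = w((2w+1)n+1) - w`), leaving
`log K_n ≥ wn log 4 + wn log (wn) + 2w²n log (2wn) - w(2w+1) n log b - (3w/2) log b`; then
`log b - log (2wn) - log ((2w+1)/(2w)) = log (1 + 1/((2w+1)n)) ≤ 1/((2w+1)n)` and
`log (wn) = log (2wn) - log 2`, `log 4 = 2 log 2` bound this below by `-κ_H(w) n - w - (3w/2) log b`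
(the `n log (2wn)` terms cancel: `w + 2w² = w(2w+1)`); finally `w + 2w log ((2w+1)n+1) ≤ ε n`
eventually (`log = o(id)`).

What is NOT here: the matching upper bound (the rate is exact), and any effective threshold.
-/

namespace Literature.NumberTheory.DiophantineApproximation

open _root_.Filter _root_.Topology _root_.Asymptotics Real

/-- **Exponential rate of `4^(wn) (wn)! ((2wn)!)^w / (((2w+1)n+1)!)^w` (sharp form, every
weight).** For every weight `w ≥ 1` and every `ε > 0`, eventually in `n`,
`exp (-(w ((2w+1) log ((2w+1)/(2w)) - log 2) + ε) n) ≤ 4^(wn) (wn)! ((2wn)!)^w / (((2w+1)n+1)!)^w`.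
This is the decay rate of the leading coefficient of the parity Hermite–Padé forms for
polylogarithms at `±1/N`; it follows from Stirling's formula (`Stirling.le_log_factorial_stirling`,
`log_factorial_succ_le`) and `log x = o(x)`. [folklore] -/
theorem eventually_exp_le_kernelH_self (w : ℕ) (hw : 1 ≤ w) {ε : ℝ} (hε : 0 < ε) :
    ∀ᶠ n : ℕ in Filter.atTop,
      Real.exp (-(((w : ℝ) * ((2 * w + 1) * Real.log ((2 * (w : ℝ) + 1) / (2 * w)) - Real.log 2)
          + ε) * n)) ≤
        (4 : ℝ) ^ (w * n) * ((w * n).factorial : ℝ) * (((2 * w * n).factorial : ℝ) ^ w) /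
          ((((2 * w + 1) * n + 1).factorial : ℝ) ^ w) := by
  have hw0 : (0 : ℝ) < w := Nat.cast_pos.mpr (by omega)
  have hw1 : (1 : ℝ) ≤ w := by exact_mod_cast hw
  -- (1) the sub-linear loss `w + 2w log ((2w+1)n+1)` is eventually at most `ε n`
  have hlog : ∀ᶠ n : ℕ in atTop,
      (w : ℝ) + 2 * w * Real.log ((2 * w + 1) * (n : ℝ) + 1) ≤ ε * n := by
    have h1 : ∀ᶠ n : ℕ in atTop, ‖Real.log (n : ℝ)‖ ≤ ε / (4 * w) * ‖id (n : ℝ)‖ :=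
      Real.isLittleO_log_id_atTop.natCast_atTop.bound (by positivity)
    have h2 : ∀ᶠ n : ℕ in atTop, (2 * w + 4 * w * Real.log (2 * w + 2)) / ε ≤ (n : ℝ) :=
      tendsto_natCast_atTop_atTop.eventually_ge_atTop _
    filter_upwards [h1, h2, eventually_ge_atTop 1] with n hn1 hn2 hn3
    have hn : (1 : ℝ) ≤ n := by exact_mod_cast hn3
    rw [id, Real.norm_eq_abs, Real.norm_eq_abs, abs_of_nonneg (Real.log_nonneg hn),
      abs_of_nonneg (zero_le_one.trans hn)] at hn1
    have h3 : 2 * w * Real.log n ≤ ε / 2 * n := by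
      have h := mul_le_mul_of_nonneg_left hn1 (by positivity : (0 : ℝ) ≤ 2 * w)
      have e : 2 * (w : ℝ) * (ε / (4 * w) * n) = ε / 2 * n := by
        field_simp
        ring
      linarith
    have h4 : Real.log ((2 * w + 1) * (n : ℝ) + 1) ≤ Real.log (2 * w + 2) + Real.log n := by
      rw [← Real.log_mul (by positivity) (by positivity)]
      exact Real.log_le_log (by positivity) (by linarith)
    have h5 : 2 * w + 4 * w * Real.log (2 * w + 2) ≤ (n : ℝ) * ε := (div_le_iff₀ hε).mp hn2
    have h6 : 2 * w * Real.log ((2 * w + 1) * (n : ℝ) + 1) ≤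
        2 * w * (Real.log (2 * w + 2) + Real.log n) :=
      mul_le_mul_of_nonneg_left h4 (by positivity)
    linarith
  -- (2) the main estimate, for `n ≥ 1` with (1)
  filter_upwards [hlog, eventually_ge_atTop 1] with n hn hn1
  have hn0 : (1 : ℝ) ≤ n := by exact_mod_cast hn1
  have hwn : (1 : ℝ) ≤ w * n := one_le_mul_of_one_le_of_one_le hw1 hn0
  -- Stirling from below for `(wn)!`, with `log (wn) = log (2wn) - log 2`
  have hA : (w : ℝ) * n * (Real.log (2 * w * n) - Real.log 2) - w * n ≤
      Real.log ((w * n).factorial : ℝ) := by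
    have h := Stirling.le_log_factorial_stirling (n := w * n) (by positivity)
    push_cast at h
    have h1 : 0 ≤ Real.log (w * n) := Real.log_nonneg hwn
    have h2 : 0 ≤ Real.log (2 * π) := Real.log_nonneg (by linarith [Real.two_le_pi])
    have h3 : Real.log ((w : ℝ) * n) = Real.log (2 * w * n) - Real.log 2 := by
      rw [mul_assoc (2 : ℝ), Real.log_mul two_ne_zero (by positivity)]
      ring
    rw [← h3]
    linarith
  -- Stirling from below for `(2wn)!`
  have hA2 : 2 * (w : ℝ) * n * Real.log (2 * w * n) - 2 * w * n ≤
      Real.log ((2 * w * n).factorial : ℝ) := by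
    have h := Stirling.le_log_factorial_stirling (n := 2 * w * n) (by positivity)
    push_cast at h
    have h1 : 0 ≤ Real.log (2 * w * n) := Real.log_nonneg (by linarith)
    have h2 : 0 ≤ Real.log (2 * π) := Real.log_nonneg (by linarith [Real.two_le_pi])
    linarith
  -- Stirling from above for `((2w+1)n+1)!`
  have hB : Real.log (((2 * w + 1) * n + 1).factorial : ℝ) ≤
      ((2 * w + 1) * n + 1) * Real.log ((2 * w + 1) * n + 1) - ((2 * w + 1) * n + 1)
        + Real.log ((2 * w + 1) * n + 1) / 2 + 1 := by
    have h := log_factorial_succ_le ((2 * w + 1) * n)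
    push_cast at h
    exact h
  -- `log ((2w+1)n+1) - log (2wn) - log ((2w+1)/(2w)) = log (1 + 1/((2w+1)n)) ≤ 1/((2w+1)n)`
  have hkey : Real.log ((2 * w + 1) * n + 1) ≤
      Real.log (2 * w * n) + Real.log ((2 * (w : ℝ) + 1) / (2 * w)) + 1 / ((2 * w + 1) * n) := by
    have h1 : Real.log (((2 * w + 1) * n + 1) / ((2 * w + 1) * n)) ≤
        ((2 * w + 1) * n + 1) / ((2 * w + 1) * n) - 1 :=
      Real.log_le_sub_one_of_pos (by positivity)
    have h2 : Real.log (((2 * w + 1) * n + 1) / ((2 * w + 1) * n)) =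
        Real.log ((2 * w + 1) * n + 1)
          - (Real.log (2 * w * n) + Real.log ((2 * (w : ℝ) + 1) / (2 * w))) := by
      have e : 2 * (w : ℝ) * n * ((2 * w + 1) / (2 * w)) = (2 * w + 1) * n := by
        field_simp
      rw [← Real.log_mul (by positivity : 2 * (w : ℝ) * n ≠ 0)
          (by positivity : (2 * (w : ℝ) + 1) / (2 * w) ≠ 0), e,
        Real.log_div (by positivity : (2 * (w : ℝ) + 1) * n + 1 ≠ 0)
          (by positivity : (2 * (w : ℝ) + 1) * n ≠ 0)]
    have h3 : ((2 * (w : ℝ) + 1) * n + 1) / ((2 * w + 1) * n) - 1 = 1 / ((2 * w + 1) * n) := by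
      field_simp
      ring
    linarith
  -- multiply by `w (2w+1) n ≥ 0`: the excess `w (2w+1) n / ((2w+1) n) = w` is a constant
  have h6 : (w : ℝ) * (2 * w + 1) * n * Real.log ((2 * w + 1) * n + 1) ≤
      (w : ℝ) * (2 * w + 1) * n * Real.log (2 * w * n)
        + (w : ℝ) * (2 * w + 1) * n * Real.log ((2 * (w : ℝ) + 1) / (2 * w)) + w := by
    have h := mul_le_mul_of_nonneg_left hkey
      (by positivity : (0 : ℝ) ≤ (w : ℝ) * (2 * w + 1) * n)
    have e : (w : ℝ) * (2 * w + 1) * n * (1 / ((2 * w + 1) * n)) = w := by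
      field_simp
    linarith
  -- weighted Stirling bounds
  have hA2' : (w : ℝ) * (2 * w * n * Real.log (2 * w * n) - 2 * w * n) ≤
      w * Real.log ((2 * w * n).factorial : ℝ) :=
    mul_le_mul_of_nonneg_left hA2 hw0.le
  have hB' : (w : ℝ) * Real.log (((2 * w + 1) * n + 1).factorial : ℝ) ≤
      w * (((2 * w + 1) * n + 1) * Real.log ((2 * w + 1) * n + 1) - ((2 * w + 1) * n + 1)
        + Real.log ((2 * w + 1) * n + 1) / 2 + 1) :=
    mul_le_mul_of_nonneg_left hB hw0.le
  have hlogb : 0 ≤ (w : ℝ) * Real.log ((2 * w + 1) * n + 1) :=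
    mul_nonneg hw0.le (Real.log_nonneg (le_add_of_nonneg_left (by positivity)))
  -- `log 4 = 2 log 2`
  have hlog4 : Real.log (4 : ℝ) = 2 * Real.log 2 := by
    rw [show (4 : ℝ) = 2 ^ 2 by norm_num, Real.log_pow]
    push_cast
    ring
  -- combine in logarithmic form
  have hR : -(((w : ℝ) * ((2 * w + 1) * Real.log ((2 * (w : ℝ) + 1) / (2 * w)) - Real.log 2)
        + ε) * n) ≤
      (w : ℝ) * n * Real.log 4 + Real.log ((w * n).factorial : ℝ)
        + w * Real.log ((2 * w * n).factorial : ℝ)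
        - w * Real.log (((2 * w + 1) * n + 1).factorial : ℝ) := by
    rw [hlog4]
    linarith
  have hApos : (0 : ℝ) < (w * n).factorial := by exact_mod_cast Nat.factorial_pos _
  have hA2pos : (0 : ℝ) < (2 * w * n).factorial := by exact_mod_cast Nat.factorial_pos _
  have hBpos : (0 : ℝ) < ((2 * w + 1) * n + 1).factorial := by exact_mod_cast Nat.factorial_pos _
  rw [← Real.exp_log (by positivity :
      (0 : ℝ) < (4 : ℝ) ^ (w * n) * ((w * n).factorial : ℝ) * ((2 * w * n).factorial : ℝ) ^ w /
        (((2 * w + 1) * n + 1).factorial : ℝ) ^ w),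
    Real.exp_le_exp, Real.log_div (by positivity) (pow_pos hBpos _).ne',
    Real.log_mul (by positivity) (pow_pos hA2pos _).ne',
    Real.log_mul (by positivity) hApos.ne', Real.log_pow, Real.log_pow, Real.log_pow]
  push_cast
  linarith

end Literature.NumberTheory.DiophantineApproximation
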